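import Literature.Algebra.EuclideanLattices.MRLemma510Function
import Literature.Computability.Cryptography.CoinBlockLaws
import Literature.Probability.Distributions.KernelIteration
import Literature.Computability.Complexity.Randomized
import HarnessLib

/-!
# Micciancio–Regev 2007, Lemma 5.10 with a probabilistic `IncGDD` solver (Cor. 5.13): the law of the loop run on uniform coins

Topic `Algebra/EuclideanLattices` (family `pqc`). Second of three files realising MR07's Lemma 5.10
(`GIVP ← IncGDD`, authors' version p. 24) at machine level, the loop behind Cor. 5.13 as invoked in the
first step of the proof of Thm. 5.23 (p. 29) — what separates the named fact
`Literature.Computability.Cryptography.owfExist_of_gapSVP_worstCaseHard` from a proof along the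
verifier-free route once an `IncGDD` solver machine (Thm. 5.9) is given. `MRLemma510Function.lean` defines
the run `loopOut c sol K T r` (rounds driven by the coin blocks of the string `r`, `k₀` oracle calls per
round with words of width `K`, answers verified by the loop itself) and proves its deterministic
invariants. This file analyses the run when `sol` is the answer function of a randomized algorithm
`Sol` and `r` is UNIFORM:

* `indepLaw_map_foldl_eq_iterate` — generic: a left fold consuming i.i.d. blocks is the iteration of the
  one-block kernel (`(μ^{⊗T}).map (foldl step s₀) = (· ≫= (s ↦ μ.map (step s)))^{T} δ_{s₀}`);
* `map_loopOut_eq_iterate` — the law of the run on uniform coins is the `T`-fold iteration of the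
  one-round kernel `roundKernel` (the chunks of a uniform string are independent uniform words,
  `CoinBlockLaws.uniformVector_map_chunks_eq_indepLaw`);
* `toReal_roundKernel_stop_le` — a running good state stops with probability `≤ (1 − q)^{k₀}`, `q` the
  solver's success probability `Sol.pr` on the round's (padded) instance, provided `K` is the solver's
  coin budget on it (product rule, `toOuterMeasure_indepLaw_pi`);
* `goodSet`, `toReal_roundKernel'_compl_goodSet_le` — the good states of the chain with a round counter
  (good rows and, while running, potential `≤ (7/8)^{rounds}` of the start; once stopped,
  `‖S‖ ≤ 16 γ η_{2⁻ⁿ}(Λ)`) are left with probability `≤ (1 − p)^{k₀}` per round when the solver answers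
  promise instances with probability `≥ p` (a stop is bad only if the promise held and all answers failed;
  a failed promise means `‖S‖` is already short, `maxNorm_le_of_not_promise`);
* **`toReal_loopOut_bad_le`** — MR07 Lemma 5.10 run with the probabilistic solver (Cor. 5.13): after `T`
  rounds with `(7/8)^T ∏‖uⱼ‖ < 1` the run has STOPPED with good rows of norm `≤ 16 γ η_{2⁻ⁿ}(Λ)`, except
  with probability `≤ T (1 − p)^{k₀}` (`KernelIteration.toReal_toOuterMeasure_iterate_compl_pure_le`).

All proved; definitions with bodies (`roundKernel`, `roundKernel'`, `goodSet`); no named fact.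

## References

* D. Micciancio, O. Regev, *Worst-case to average-case reductions based on Gaussian measures*,
  SIAM J. Comput. 37 (2007) 267–302; authors' version (`lit read doi:10.1137/S0097539705447360`),
  Lemma 5.10 and its proof (p. 24), Cor. 5.13 (p. 25), Thm. 5.23 (proof, first step, p. 29).
* S. Arora, B. Barak, *Computational Complexity: A Modern Approach*, CUP 2009, Def. 7.1 and §7.4.1
  (a probabilistic machine reads a uniform string; independent repetitions) [AroraBarak2009].
-/

noncomputable section

namespace Literature.Algebra.EuclideanLattices

namespace MRLemma510

open Literature.Computability.Complexity Literature.Computability.Cryptography Literature.Probability.Distributions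
  PMF MeasureTheory
open scoped ENNReal

/-! ### Coin blocks -/

/-- `blocksOf` as the `ofFn` list of the blocks of the `chunks` family. [folklore] -/
theorem blocksOf_eq_ofFn (K k₀ T : ℕ) {C : ℕ} (hC : K * k₀ * T ≤ C) (r : List.Vector Bool C) :
    blocksOf K k₀ T r.toList = List.ofFn fun j : Fin T => wordsOf K k₀ (chunks (K * k₀) T hC r j).toList := by
  refine List.ext_getElem (by simp [blocksOf]) fun j h₁ h₂ => ?_
  simp [blocksOf, wordsOf]

/-- `wordsOf` as the `ofFn` list of the `chunks` family of a block. [folklore] -/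
theorem wordsOf_eq_ofFn (K k₀ : ℕ) (b : List.Vector Bool (K * k₀)) :
    wordsOf K k₀ b.toList = List.ofFn fun l : Fin k₀ => (chunks K k₀ le_rfl b l).toList := by
  refine List.ext_getElem (by simp [wordsOf]) fun j h₁ h₂ => ?_
  simp [wordsOf]

/-- **The run is a left fold over the blocks of the `chunks` family.** [folklore] -/
theorem loopOut_eq_foldl (c : Ctx) (sol : List Bool → List Bool → List Bool) (K T : ℕ) {C : ℕ}
    (hC : K * c.k₀ * T ≤ C) (r : List.Vector Bool C) :
    loopOut c sol K T r.toList =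
      (List.ofFn (chunks (K * c.k₀) T hC r)).foldl
        (fun st b => roundUpdate c sol st (wordsOf K c.k₀ b.toList)) (true, c.U) := by
  rw [loopOut, loopRun, blocksOf_eq_ofFn K c.k₀ T hC r, List.ofFn_eq_map, List.ofFn_eq_map, List.foldl_map, List.foldl_map]

/-! ### Folds of independent blocks are kernel iterations -/

/-- Iterating a `bind` commutes with an initial `bind`. [folklore] -/
theorem iterate_bind_bind {σ β : Type*} (κ : σ → PMF σ) (μ : PMF β) (f : β → PMF σ) :
    ∀ T : ℕ, (fun ν : PMF σ => ν.bind κ)^[T] (μ.bind f) = μ.bind fun b => (fun ν : PMF σ => ν.bind κ)^[T] (f b)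
  | 0 => rfl
  | T + 1 => by
    rw [Function.iterate_succ_apply, PMF.bind_bind, iterate_bind_bind κ μ _ T]
    rfl

/-- **A left fold consuming independent identically distributed blocks is the iteration of the
one-block kernel**: `(μ^{⊗T}).map (b ↦ foldl step s₀ [b₀, …, b_{T-1}]) = (· ≫= (s ↦ μ.map (step s)))^{T} δ_{s₀}`.
[cite: AroraBarak2009, §7.4.1 (independent repetitions)] -/
theorem indepLaw_map_foldl_eq_iterate {σ β : Type*} (μ : PMF β) (step : σ → β → σ) :
    ∀ (T : ℕ) (s₀ : σ), (indepLaw T fun _ => μ).map (fun b => (List.ofFn b).foldl step s₀) =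
      (fun ν : PMF σ => ν.bind fun s => μ.map (step s))^[T] (PMF.pure s₀)
  | 0, s₀ => by
    rw [indepLaw_zero, PMF.pure_map, Function.iterate_zero_apply]
    simp
  | T + 1, s₀ => by
    rw [indepLaw_succ, PMF.map_bind, Function.iterate_succ_apply, PMF.pure_bind,
      show μ.map (step s₀) = μ.bind (fun b => PMF.pure (step s₀ b)) from rfl, iterate_bind_bind]
    congr 1
    funext b
    rw [PMF.map_comp, ← indepLaw_map_foldl_eq_iterate μ step T (step s₀ b)]
    congr 1
    funext v
    simp [List.ofFn_succ]

/-! ### One round on a uniform block -/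

variable (c : Ctx) (Sol : RandAlg (List Bool) (List Bool)) (K : ℕ)

/-- **The one-round kernel**: the state after a round whose block is uniform in `{0,1}^{K k₀}`.
[cite: MicciancioRegev2007, Lemma 5.10 (one iteration) with Cor. 5.13] -/
def roundKernel (st : Bool × List (List ℤ)) : PMF (Bool × List (List ℤ)) :=
  (uniformOfFintype (List.Vector Bool (K * c.k₀))).map fun b => roundUpdate c Sol.run st (wordsOf K c.k₀ b.toList)

/-- **The law of the run on uniform coins is the `T`-fold iteration of the one-round kernel.**
[cite: AroraBarak2009, Def. 7.1, §7.4.1] -/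
theorem map_loopOut_eq_iterate (T : ℕ) {C : ℕ} (hC : K * c.k₀ * T ≤ C) :
    (uniformOfFintype (List.Vector Bool C)).map (fun r => loopOut c Sol.run K T r.toList) =
      (fun ν : PMF (Bool × List (List ℤ)) => ν.bind (roundKernel c Sol K))^[T] (PMF.pure (true, c.U)) := by
  have h1 : (fun r : List.Vector Bool C => loopOut c Sol.run K T r.toList) =
      (fun b : Fin T → List.Vector Bool (K * c.k₀) =>
        (List.ofFn b).foldl (fun st b => roundUpdate c Sol.run st (wordsOf K c.k₀ b.toList)) (true, c.U)) ∘
        chunks (K * c.k₀) T hC := by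
    funext r
    exact loopOut_eq_foldl c Sol.run K T hC r
  rw [h1, ← PMF.map_comp, uniformVector_map_chunks_eq_indepLaw, indepLaw_map_foldl_eq_iterate]
  rfl

/-- Complements, real form: `Pr[S] + Pr[Sᶜ] = 1`. [folklore] -/
theorem toReal_toOuterMeasure_add_compl {α : Type*} (q : PMF α) (S : Set α) :
    (q.toOuterMeasure S).toReal + (q.toOuterMeasure Sᶜ).toReal = 1 := by
  have h : q.toOuterMeasure S + q.toOuterMeasure Sᶜ = 1 := by
    rw [PMF.toOuterMeasure_apply, PMF.toOuterMeasure_apply, ← ENNReal.tsum_add, ← q.tsum_coe]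
    exact tsum_congr fun x => Set.indicator_self_add_compl_apply S q x
  have hS : q.toOuterMeasure S ≠ ∞ := ne_top_of_le_ne_top ENNReal.one_ne_top (h ▸ le_self_add)
  have hSc : q.toOuterMeasure Sᶜ ≠ ∞ := ne_top_of_le_ne_top ENNReal.one_ne_top (h ▸ le_add_self)
  have := congrArg ENNReal.toReal h
  rwa [ENNReal.toReal_add hS hSc, ENNReal.toReal_one] at this

/-- Complements, real form: `Pr[Sᶜ] ≤ 1 − Pr[S]`. [folklore] -/
theorem toReal_toOuterMeasure_compl_le {α : Type*} (q : PMF α) (S : Set α) :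
    (q.toOuterMeasure Sᶜ).toReal ≤ 1 - (q.toOuterMeasure S).toReal := by
  have := toReal_toOuterMeasure_add_compl q S
  linarith

/-- Uniform coin vectors of (propositionally) equal lengths have the same push-forwards. [folklore] -/
theorem map_uniformVector_toList_congr {β : Type*} (f : List Bool → β) {n m : ℕ} (h : n = m) :
    (uniformOfFintype (List.Vector Bool n)).map (fun w => f w.toList) =
      (uniformOfFintype (List.Vector Bool m)).map (fun w => f w.toList) := by
  subst h; rfl

/-- The mass of any event under a `PMF` is finite. [folklore] -/
theorem toOuterMeasure_ne_top' {α : Type*} (q : PMF α) (S : Set α) : q.toOuterMeasure S ≠ ∞ :=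
  ne_top_of_le_ne_top ENNReal.one_ne_top
    (le_trans (measure_mono (Set.subset_univ S)) ((PMF.toOuterMeasure_apply_eq_one_iff q Set.univ).2
      (Set.subset_univ _)).le)

/-- **A running good state stops with probability `≤ (1 − q)^{k₀}`**, `q` the solver's success
probability on the round's instance, provided the word width `K` is the solver's coin budget on it:
stopping needs all `k₀` independent answers to be bad.
[cite: MicciancioRegev2007, Cor. 5.13 (Lemma 5.10 run with the probabilistic solver of Thm. 5.9, repeated)] -/
theorem toReal_roundKernel_stop_le {V : List (List ℤ)} (hc : c.WF) (hV : GoodRows c V)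
    (hK : Sol.coinLen (roundInst c V).encode.length = K) :
    ((roundKernel c Sol K (true, V)).toOuterMeasure {st | st = (false, V)}).toReal ≤
      (1 - Sol.pr id (roundInst c V).encode (roundInst c V).goodAnswers) ^ c.k₀ := by
  classical
  set J := roundInst c V with hJ
  -- stopping forces every answer to be bad
  have hsub : (fun b : List.Vector Bool (K * c.k₀) => roundUpdate c Sol.run (true, V) (wordsOf K c.k₀ b.toList)) ⁻¹'
      {st | st = (false, V)} ⊆
      (chunks K c.k₀ le_rfl) ⁻¹' {w : Fin c.k₀ → List.Vector Bool K | ∀ l, Sol.run J.encode (w l).toList ∈ J.goodAnswersᶜ} := by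
    intro b hb
    simp only [Set.mem_preimage, Set.mem_setOf_eq] at hb ⊢
    intro l
    rcases roundUpdate_running hc Sol.run hV (wordsOf K c.k₀ b.toList) with ⟨V', h1, -⟩ | ⟨-, h2⟩
    · rw [h1] at hb; simp at hb
    · have hmem : (chunks K c.k₀ le_rfl b l).toList ∈ wordsOf K c.k₀ b.toList := by
        rw [wordsOf_eq_ofFn]; exact List.mem_ofFn.2 ⟨l, rfl⟩
      exact h2 _ hmem
  have hmono := measure_mono (μ := (uniformOfFintype (List.Vector Bool (K * c.k₀))).toOuterMeasure) hsub
  rw [roundKernel, PMF.toOuterMeasure_map_apply]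
  refine le_trans (ENNReal.toReal_mono (toOuterMeasure_ne_top' _ _) hmono) ?_
  -- the product event under the product law
  rw [← PMF.toOuterMeasure_map_apply, uniformVector_map_chunks_eq_indepLaw,
    show {w : Fin c.k₀ → List.Vector Bool K | ∀ l, Sol.run J.encode (w l).toList ∈ J.goodAnswersᶜ} =
      {w | ∀ l, w l ∈ (fun _ : Fin c.k₀ => (fun v : List.Vector Bool K => Sol.run J.encode v.toList) ⁻¹'
        J.goodAnswersᶜ) l} from rfl,
    toOuterMeasure_indepLaw_pi, Finset.prod_const, Finset.card_univ, Fintype.card_fin, ENNReal.toReal_pow]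
  -- one word: `Pr[answer bad] ≤ 1 - Pr[answer good]`, and the good probability is `Sol.pr`
  have hout : Sol.outputPMF id J.encode =
      (uniformOfFintype (List.Vector Bool K)).map fun w => Sol.run J.encode w.toList :=
    map_uniformVector_toList_congr (Sol.run J.encode) hK
  have hgood : Sol.pr id J.encode J.goodAnswers = (((uniformOfFintype (List.Vector Bool K)).map
      fun w => Sol.run J.encode w.toList).toOuterMeasure J.goodAnswers).toReal := by
    rw [RandAlg.pr, hout]
  rw [hgood, ← PMF.toOuterMeasure_map_apply]
  exact pow_le_pow_left₀ ENNReal.toReal_nonneg (toReal_toOuterMeasure_compl_le _ _) _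

/-! ### The analysed chain: states with a round counter -/

/-- The good states of the chain `(rounds done, (running?, rows))`: good rows and, while running, a
potential at most `(7/8)^{rounds}` of the start; once stopped, `‖S‖ ≤ 16 γ η_{2⁻ⁿ}(Λ)`.
[cite: MicciancioRegev2007, Lemma 5.10 (proof: potential argument and the stopping guarantee)] -/
def goodSet (γ : ℝ) : Set (ℕ × (Bool × List (List ℤ))) :=
  {s | GoodRows c s.2.2 ∧
    ((s.2.1 = true ∧ potential c.n s.2.2 ≤ (7 / 8 : ℝ) ^ s.1 * potential c.n c.U) ∨
      (s.2.1 = false ∧ Real.sqrt (roundA s.2.2) ≤ 16 * (γ * smoothingParameter c.lattice ((2⁻¹ : ℝ) ^ c.n))))}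

/-- The one-round kernel with the counter. [folklore] -/
def roundKernel' (s : ℕ × (Bool × List (List ℤ))) : PMF (ℕ × (Bool × List (List ℤ))) :=
  (uniformOfFintype (List.Vector Bool (K * c.k₀))).map fun b =>
    (s.1 + 1, roundUpdate c Sol.run s.2 (wordsOf K c.k₀ b.toList))

/-- A counting fold tracks the length. [folklore] -/
theorem foldl_count {β σ : Type*} (step : σ → β → σ) (l : List β) : ∀ (j : ℕ) (s : σ),
    l.foldl (fun p b => (p.1 + 1, step p.2 b)) (j, s) = (j + l.length, l.foldl step s) := by
  induction l with
  | nil => intro j s; simp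
  | cons b l ih => intro j s; rw [List.foldl_cons, List.foldl_cons, ih]; simp; omega

/-- **The law of `(T, run)` on uniform coins is the `T`-fold iteration of the counting kernel.** [folklore] -/
theorem map_count_loopOut_eq_iterate (T : ℕ) {C : ℕ} (hC : K * c.k₀ * T ≤ C) :
    (uniformOfFintype (List.Vector Bool C)).map (fun r => (T, loopOut c Sol.run K T r.toList)) =
      (fun ν : PMF (ℕ × (Bool × List (List ℤ))) => ν.bind (roundKernel' c Sol K))^[T] (PMF.pure (0, (true, c.U))) := by
  have h1 : (fun r : List.Vector Bool C => (T, loopOut c Sol.run K T r.toList)) =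
      (fun b : Fin T → List.Vector Bool (K * c.k₀) =>
        (List.ofFn b).foldl (fun p b => (p.1 + 1, roundUpdate c Sol.run p.2 (wordsOf K c.k₀ b.toList))) (0, (true, c.U))) ∘
        chunks (K * c.k₀) T hC := by
    funext r
    have h := foldl_count (fun s (b : List.Vector Bool (K * c.k₀)) => roundUpdate c Sol.run s (wordsOf K c.k₀ b.toList))
      (List.ofFn (chunks (K * c.k₀) T hC r)) 0 (true, c.U)
    beta_reduce at h
    rw [Function.comp_apply, h, List.length_ofFn, zero_add, loopOut_eq_foldl c Sol.run K T hC r]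
  rw [h1, ← PMF.map_comp, uniformVector_map_chunks_eq_indepLaw, indepLaw_map_foldl_eq_iterate]
  rfl

/-- **Each round leaves the good states with probability `≤ (1 − p)^{k₀}`** when the solver succeeds
with probability `≥ p` on every promise instance met along the run: a running good state either accepts
(potential `× 7/8`, still good) or stops, which is bad only if the promise held and all `k₀` answers
failed; a stopped state stays. [cite: MicciancioRegev2007, Lemma 5.10 (proof) with Cor. 5.13] -/
theorem toReal_roundKernel'_compl_goodSet_le (hc : c.WF) {γ p : ℝ} (hp1 : p ≤ 1)
    (hK : ∀ V, GoodRows c V → Sol.coinLen (roundInst c V).encode.length = K)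
    (hsol : ∀ V, GoodRows c V → (roundInst c V).Promise γ →
      p ≤ Sol.pr id (roundInst c V).encode (roundInst c V).goodAnswers)
    (s : ℕ × (Bool × List (List ℤ))) (hs : s ∈ goodSet c γ) :
    ((roundKernel' c Sol K s).toOuterMeasure (goodSet c γ)ᶜ).toReal ≤ (1 - p) ^ c.k₀ := by
  classical
  obtain ⟨j, run, V⟩ := s
  obtain ⟨hV, hcase⟩ := hs
  dsimp only at hV hcase
  rw [roundKernel', PMF.toOuterMeasure_map_apply]
  rcases hcase with ⟨rfl, hpot⟩ | ⟨rfl, hshort⟩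
  · -- running
    by_cases hprom : (roundInst c V).Promise γ
    · -- bad outcomes are stops
      have hsub : (fun b : List.Vector Bool (K * c.k₀) =>
            (j + 1, roundUpdate c Sol.run (true, V) (wordsOf K c.k₀ b.toList))) ⁻¹' (goodSet c γ)ᶜ ⊆
          (fun b : List.Vector Bool (K * c.k₀) => roundUpdate c Sol.run (true, V) (wordsOf K c.k₀ b.toList)) ⁻¹'
            {st | st = (false, V)} := by
        intro b hb
        simp only [Set.mem_preimage, Set.mem_compl_iff, Set.mem_setOf_eq] at hb ⊢
        rcases roundUpdate_running hc Sol.run hV (wordsOf K c.k₀ b.toList) with ⟨V', h1, hV', -, -, hpot'⟩ | ⟨h2, -⟩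
        · exfalso
          apply hb
          rw [h1]
          refine ⟨hV', Or.inl ⟨rfl, ?_⟩⟩
          calc potential c.n V' ≤ 7 / 8 * potential c.n V := hpot'
            _ ≤ 7 / 8 * ((7 / 8 : ℝ) ^ j * potential c.n c.U) := by gcongr
            _ = (7 / 8 : ℝ) ^ (j + 1) * potential c.n c.U := by ring
        · exact h2
      have hmono := measure_mono (μ := (uniformOfFintype (List.Vector Bool (K * c.k₀))).toOuterMeasure) hsub
      refine le_trans (ENNReal.toReal_mono (toOuterMeasure_ne_top' _ _) hmono) ?_
      have h := toReal_roundKernel_stop_le c Sol K hc hV (hK V hV)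
      rw [roundKernel, PMF.toOuterMeasure_map_apply] at h
      refine h.trans ?_
      have hq := hsol V hV hprom
      have hq1 : Sol.pr id (roundInst c V).encode (roundInst c V).goodAnswers ≤ 1 :=
        PMF.toReal_toOuterMeasure_le_one _ _
      exact pow_le_pow_left₀ (by linarith) (by linarith) _
    · -- no promise: every outcome is good
      have hsub : (fun b : List.Vector Bool (K * c.k₀) =>
            (j + 1, roundUpdate c Sol.run (true, V) (wordsOf K c.k₀ b.toList))) ⁻¹' (goodSet c γ)ᶜ ⊆ ∅ := by
        intro b hb
        simp only [Set.mem_preimage, Set.mem_compl_iff] at hb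
        apply hb
        rcases roundUpdate_running hc Sol.run hV (wordsOf K c.k₀ b.toList) with ⟨V', h1, hV', -, -, hpot'⟩ | ⟨h2, -⟩
        · rw [h1]
          refine ⟨hV', Or.inl ⟨rfl, ?_⟩⟩
          calc potential c.n V' ≤ 7 / 8 * potential c.n V := hpot'
            _ ≤ 7 / 8 * ((7 / 8 : ℝ) ^ j * potential c.n c.U) := by gcongr
            _ = (7 / 8 : ℝ) ^ (j + 1) * potential c.n c.U := by ring
        · rw [h2]
          exact ⟨hV, Or.inr ⟨rfl, maxNorm_le_of_not_promise hc hV hprom⟩⟩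
      have hmono := measure_mono (μ := (uniformOfFintype (List.Vector Bool (K * c.k₀))).toOuterMeasure) hsub
      rw [measure_empty, nonpos_iff_eq_zero] at hmono
      change ((uniformOfFintype (List.Vector Bool (K * c.k₀))).toOuterMeasure
        ((fun b : List.Vector Bool (K * c.k₀) =>
          (j + 1, roundUpdate c Sol.run (true, V) (wordsOf K c.k₀ b.toList))) ⁻¹' (goodSet c γ)ᶜ)).toReal ≤ _
      rw [hmono, ENNReal.toReal_zero]
      exact pow_nonneg (by linarith) _
  · -- stopped: deterministic, stays good
    have hsub : (fun b : List.Vector Bool (K * c.k₀) =>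
          (j + 1, roundUpdate c Sol.run (false, V) (wordsOf K c.k₀ b.toList))) ⁻¹' (goodSet c γ)ᶜ ⊆ ∅ := by
      intro b hb
      simp only [Set.mem_preimage, Set.mem_compl_iff, roundUpdate_stopped] at hb
      exact hb ⟨hV, Or.inr ⟨rfl, hshort⟩⟩
    have hmono := measure_mono (μ := (uniformOfFintype (List.Vector Bool (K * c.k₀))).toOuterMeasure) hsub
    rw [measure_empty, nonpos_iff_eq_zero] at hmono
    change ((uniformOfFintype (List.Vector Bool (K * c.k₀))).toOuterMeasure
      ((fun b : List.Vector Bool (K * c.k₀) =>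
        (j + 1, roundUpdate c Sol.run (false, V) (wordsOf K c.k₀ b.toList))) ⁻¹' (goodSet c γ)ᶜ)).toReal ≤ _
    rw [hmono, ENNReal.toReal_zero]
    exact pow_nonneg (by linarith) _

/-- **The law of the loop (MR07 Lemma 5.10 run with a probabilistic `IncGDD` solver, Cor. 5.13):**
if the solver's coin budget is `K` on every instance met from a good state and it answers well with
probability `≥ p` whenever such an instance satisfies the `IncGDD^{η}_{γ}` promise, then after `T` rounds
with `(7/8)^T · ∏‖uⱼ‖ < 1` the run has STOPPED with good rows of norm `≤ 16 γ η_{2⁻ⁿ}(Λ)`, except with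
probability `≤ T (1 − p)^{k₀}` over the uniform coins.
[cite: MicciancioRegev2007, Lemma 5.10 (proof, p. 24) and Cor. 5.13 (p. 25)] -/
theorem toReal_loopOut_bad_le (hc : c.WF) {T C : ℕ} (hC : K * c.k₀ * T ≤ C) {γ p : ℝ} (hp1 : p ≤ 1)
    (hK : ∀ V, GoodRows c V → Sol.coinLen (roundInst c V).encode.length = K)
    (hsol : ∀ V, GoodRows c V → (roundInst c V).Promise γ →
      p ≤ Sol.pr id (roundInst c V).encode (roundInst c V).goodAnswers)
    (hT : (7 / 8 : ℝ) ^ T * potential c.n c.U < 1) :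
    ((uniformOfFintype (List.Vector Bool C)).toOuterMeasure
      {r | ¬ ((loopOut c Sol.run K T r.toList).1 = false ∧ GoodRows c (loopOut c Sol.run K T r.toList).2 ∧
        Real.sqrt (roundA (loopOut c Sol.run K T r.toList).2) ≤
          16 * (γ * smoothingParameter c.lattice ((2⁻¹ : ℝ) ^ c.n)))}).toReal ≤ T * (1 - p) ^ c.k₀ := by
  classical
  -- good final states of the chain are good outputs
  have hsub : {r : List.Vector Bool C | ¬ ((loopOut c Sol.run K T r.toList).1 = false ∧
        GoodRows c (loopOut c Sol.run K T r.toList).2 ∧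
        Real.sqrt (roundA (loopOut c Sol.run K T r.toList).2) ≤
          16 * (γ * smoothingParameter c.lattice ((2⁻¹ : ℝ) ^ c.n)))} ⊆
      (fun r : List.Vector Bool C => (T, loopOut c Sol.run K T r.toList)) ⁻¹' (goodSet c γ)ᶜ := by
    intro r hr
    simp only [Set.mem_setOf_eq, Set.mem_preimage, Set.mem_compl_iff] at hr ⊢
    intro hg
    apply hr
    obtain ⟨hV, hcase⟩ := hg
    rcases hcase with ⟨hrun, hpot⟩ | ⟨hstop, hshort⟩
    · exfalso
      have h1 := one_le_potential hV
      dsimp only at hpot h1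
      linarith
    · exact ⟨hstop, hV, hshort⟩
  have hmono := measure_mono (μ := (uniformOfFintype (List.Vector Bool C)).toOuterMeasure) hsub
  refine le_trans (ENNReal.toReal_mono (toOuterMeasure_ne_top' _ _) hmono) ?_
  rw [← PMF.toOuterMeasure_map_apply, map_count_loopOut_eq_iterate c Sol K T hC]
  have h0 : ((0 : ℕ), (true, c.U)) ∈ goodSet c γ :=
    ⟨goodRows_start hc, Or.inl ⟨rfl, by simp⟩⟩
  have h := PMF.toReal_toOuterMeasure_iterate_compl_pure_le (roundKernel' c Sol K) (goodSet c γ)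
    (η := (1 - p) ^ c.k₀) (pow_nonneg (by linarith) _)
    (toReal_roundKernel'_compl_goodSet_le c Sol K hc hp1 hK hsol) T h0
  exact h

end MRLemma510

end Literature.Algebra.EuclideanLattices

end
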